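import Mathlib.Analysis.Normed.Algebra.GelfandFormula
import Mathlib.Analysis.Complex.CauchyIntegral
import Mathlib.Analysis.Normed.Operator.Banach
import HarnessLib

/-!
# Kato's Riesz projection as a contour integral of the resolvent: vanishing and eigenvectors

Analysis/OperatorTheory support file (one definition with body, everything proved, no named
facts). For an element `a` of a complex Banach algebra `A` (e.g. a bounded operator
`T : E →L[ℂ] E` on a complex Banach space) Kato (1966, III-§6.4, Thm. 6.17, (6.19)) separates a
bounded part of the spectrum enclosed by a closed curve `Γ ⊂ P(T)` by the projection
`P = −(2πi)⁻¹ ∮_Γ R(ζ) dζ`, `R(ζ) = (T − ζ)⁻¹`. With Mathlib's `resolvent a z = (z − a)⁻¹ = −R(z)`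
and the circle `Γ = C(c, R)` this is

  `rieszProjection a c R := (2πi)⁻¹ • ∮ z in C(c, R), resolvent a z`.

This file records the two elementary facts about this integral that turn "the spectral
projection is non-trivial" into "there is spectrum inside the curve" — the concluding step of the
proof of Albritton–Brué–Colombo 2022, Prop. 2.6 (arXiv:2112.03116, end of §2.4: "since `Pr_∞` is
non-trivial, we must have that `Pr_ℓ` is non-trivial for all sufficiently large `ℓ`", whence an
unstable eigenvalue of the truncated ring operator) and of every perturbation argument for
isolated eigenvalues (Kato IV-§3.4–3.5):

* `circleIntegral_resolvent_eq_zero` / `rieszProjection_eq_zero`: if the CLOSED disc lies in the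
  resolvent set, `∮_{C(c,R)} resolvent a z dz = 0` (Cauchy's theorem for the analytic resolvent,
  Mathlib `circleIntegral_eq_zero_of_differentiable_on_off_countable` +
  `spectrum.hasDerivAt_resolvent_const_left`); contrapositively
  (`spectrum_inter_ball_nonempty_of_circleIntegral_ne_zero`,
  `spectrum_inter_ball_nonempty_of_rieszProjection_ne_zero`) **a non-zero Riesz integral over a
  circle in the resolvent set forces spectrum in the open disc**;
* `circleIntegral_resolvent_apply_of_apply_eq_smul` / `rieszProjection_apply_of_apply_eq_smul`:
  for an eigenvector `T v = μ v` with `μ` inside the circle, `resolvent T z v = (z − μ)⁻¹ v` on the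
  resolvent set (`resolvent_apply_of_apply_eq_smul`), hence `(∮ resolvent T z dz) v = 2πi v` and
  **`P v = v`** (Kato III-§6.5: the eigenspace lies in `M′ = PX`); in particular the Riesz
  integral is non-zero as soon as there is an eigenvalue inside
  (`circleIntegral_resolvent_ne_zero_of_apply_eq_smul`).

Not here (the genuinely harder parts of Kato III-§6.4): `P² = P`, `PT ⊂ TP`, and
`σ(T_{M′}) = Σ′`; the tree's `Literature.Analysis.OperatorTheory.IsRieszDecomposition`
(`AlgebraicMultiplicity.lean`) axiomatises their outcome.

## Mathlib / tree search

Mathlib (this pin) has the resolvent (`resolvent`, `spectrum.resolvent_eq`,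
`spectrum.hasDerivAt_resolvent_const_left`), circle integrals with Cauchy's theorem and
`∮ (z − w)⁻¹ dz = 2πi` (`circleIntegral.integral_sub_inv_of_mem_ball`), but no Riesz/spectral
projection by contour integration (searched `rieszProjection`, `spectralProjection`,
`circleIntegral.*resolvent`: none in Mathlib or Literature; the tree's
`CompactSelfAdjointResolvent.lean` has the resolvent algebra on Hilbert spaces only).

## References

* T. Kato, *Perturbation Theory for Linear Operators*, Springer 1966, III-§6.4, Thm. 6.17 and
  (6.19) `P = −(2πi)⁻¹∫_Γ R(ζ)dζ` (held copy `book:kato1966-perturbation-theory-linear-operators`,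
  chunk p0221), III-§6.5 (isolated eigenvalues). [Kato1966]
* D. Albritton, E. Brué, M. Colombo, *Non-uniqueness of Leray solutions of the forced
  Navier–Stokes equations*, Ann. of Math. 196 (2022), arXiv:2112.03116, §2.4, proof of Prop. 2.6
  (spectral projections `Pr_ℓ = (2πi)⁻¹∫ R(λ, L_ℓP_ℓ) dλ`). [AlbrittonBrueColombo2022AnnMath]
-/

noncomputable section

open Complex MeasureTheory Metric Set Filter Topology

namespace Literature.Analysis.OperatorTheory

/-! ### The Riesz integral in a Banach algebra -/

section BanachAlgebra

variable {A : Type*} [NormedRing A] [NormedAlgebra ℂ A] [CompleteSpace A]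

/-- **Kato's Riesz projection over a circle**: `P = (2πi)⁻¹ ∮_{C(c,R)} (z − a)⁻¹ dz`
(Kato 1966, III-§6.4 (6.19), written with Mathlib's `resolvent a z = (z − a)⁻¹ = −R(z)`, which
absorbs Kato's minus sign). It is a genuine projection onto the spectral subspace of the part of
`σ(a)` inside the circle when the circle runs in the resolvent set (Kato, Thm. 6.17; not proved
here). [cite: Kato1966, III-§6.4 Thm. 6.17 (6.19)] -/
def rieszProjection (a : A) (c : ℂ) (R : ℝ) : A :=
  (2 * Real.pi * I)⁻¹ • ∮ z in C(c, R), resolvent a z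

omit [CompleteSpace A] in
/-- Unfolding `rieszProjection`. [cite: Kato1966, III-§6.4 (6.19)] -/
theorem rieszProjection_def (a : A) (c : ℂ) (R : ℝ) :
    rieszProjection a c R = (2 * Real.pi * I)⁻¹ • ∮ z in C(c, R), resolvent a z := rfl

/-- The resolvent is continuous on the resolvent set (it is even analytic there;
Kato I-§5.2 / III-§6.1). [folklore] -/
theorem continuousOn_resolvent (a : A) : ContinuousOn (resolvent a) (resolventSet ℂ a) :=
  fun _ hz => (spectrum.hasDerivAt_resolvent_const_left hz).continuousAt.continuousWithinAt

/-- **Cauchy's theorem for the resolvent**: if the closed disc `|z − c| ≤ R` lies in the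
resolvent set of `a`, then `∮_{C(c,R)} (z − a)⁻¹ dz = 0` (the resolvent is holomorphic on a
neighbourhood of the disc; Kato III-§6.4, the case `Σ′ = ∅` of Thm. 6.17). [cite: Kato1966, III-§6.4 Thm. 6.17 (6.19)] -/
theorem circleIntegral_resolvent_eq_zero {a : A} {c : ℂ} {R : ℝ} (hR : 0 ≤ R)
    (h : closedBall c R ⊆ resolventSet ℂ a) : (∮ z in C(c, R), resolvent a z) = 0 :=
  circleIntegral_eq_zero_of_differentiable_on_off_countable hR countable_empty
    ((continuousOn_resolvent a).mono h)
    fun _ hz => (spectrum.hasDerivAt_resolvent_const_left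
      (h (ball_subset_closedBall hz.1))).differentiableAt

/-- The Riesz projection over a circle whose closed disc lies in the resolvent set vanishes.
[cite: Kato1966, III-§6.4 Thm. 6.17 (6.19)] -/
theorem rieszProjection_eq_zero {a : A} {c : ℂ} {R : ℝ} (hR : 0 ≤ R)
    (h : closedBall c R ⊆ resolventSet ℂ a) : rieszProjection a c R = 0 := by
  rw [rieszProjection_def, circleIntegral_resolvent_eq_zero hR h, smul_zero]

/-- **A non-zero Riesz integral forces spectrum inside the circle.** If the circle `|z − c| = R`
lies in the resolvent set and `∮_{C(c,R)} (z − a)⁻¹ dz ≠ 0`, then `σ(a)` meets the open disc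
`|z − c| < R` (contrapositive of `circleIntegral_resolvent_eq_zero`). This is the step "the
spectral projection is non-trivial, hence there is an (unstable) eigenvalue inside the curve" at
the end of the proof of Albritton–Brué–Colombo 2022, Prop. 2.6.
[cite: Kato1966, III-§6.4 Thm. 6.17 (6.19)] -/
theorem spectrum_inter_ball_nonempty_of_circleIntegral_ne_zero {a : A} {c : ℂ} {R : ℝ}
    (hR : 0 ≤ R) (hs : sphere c R ⊆ resolventSet ℂ a)
    (hne : (∮ z in C(c, R), resolvent a z) ≠ 0) : (spectrum ℂ a ∩ ball c R).Nonempty := by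
  by_contra h
  refine hne (circleIntegral_resolvent_eq_zero hR fun z hz => ?_)
  rcases (mem_closedBall.1 hz).eq_or_lt with heq | hlt
  · exact hs (mem_sphere.2 heq)
  · by_contra hzρ
    exact h ⟨z, spectrum.mem_iff.2 fun hu => hzρ (spectrum.mem_resolventSet_iff.2 hu),
      mem_ball.2 hlt⟩

/-- `rieszProjection a c R ≠ 0` with the circle in the resolvent set forces spectrum in the open
disc. [cite: Kato1966, III-§6.4 Thm. 6.17 (6.19)] -/
theorem spectrum_inter_ball_nonempty_of_rieszProjection_ne_zero {a : A} {c : ℂ} {R : ℝ}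
    (hR : 0 ≤ R) (hs : sphere c R ⊆ resolventSet ℂ a) (hne : rieszProjection a c R ≠ 0) :
    (spectrum ℂ a ∩ ball c R).Nonempty :=
  spectrum_inter_ball_nonempty_of_circleIntegral_ne_zero hR hs fun h0 =>
    hne (by rw [rieszProjection_def, h0, smul_zero])

end BanachAlgebra

/-! ### Eigenvectors: `R(z) v = (z − μ)⁻¹ v` and `P v = v` -/

section Operator

variable {E : Type*} [NormedAddCommGroup E] [NormedSpace ℂ E] [CompleteSpace E]

omit [CompleteSpace E] in
/-- `(μ − T)` as an operator: `(μ − T) x = μ x − T x`. [folklore] -/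
theorem algebraMap_sub_apply' (T : E →L[ℂ] E) (μ : ℂ) (x : E) :
    (algebraMap ℂ (E →L[ℂ] E) μ - T) x = μ • x - T x := by
  simp [Algebra.algebraMap_eq_smul_one]

/-- An eigenvalue with a non-zero eigenvector belongs to the spectrum (`μ − T` is not injective,
hence not a unit; Kato III-§6.1). [folklore] -/
theorem mem_spectrum_of_apply_eq_smul {T : E →L[ℂ] E} {μ : ℂ} {v : E} (hv : T v = μ • v)
    (hv0 : v ≠ 0) : μ ∈ spectrum ℂ T := by
  rw [spectrum.mem_iff]
  intro hu
  have hinj := (ContinuousLinearMap.isUnit_iff_bijective.1 hu).1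
  refine hv0 (hinj ?_)
  rw [algebraMap_sub_apply', hv, sub_self, map_zero]

/-- **The resolvent acts on an eigenvector by the scalar resolvent**: if `T v = μ v` and `z` is
in the resolvent set then `(z − T)⁻¹ v = (z − μ)⁻¹ v` (apply `(z − T)⁻¹` to
`(z − T) v = (z − μ) v`; for `v ≠ 0` necessarily `z ≠ μ`). [folklore] -/
theorem resolvent_apply_of_apply_eq_smul {T : E →L[ℂ] E} {μ : ℂ} {v : E} (hv : T v = μ • v)
    {z : ℂ} (hz : z ∈ resolventSet ℂ T) : resolvent T z v = (z - μ)⁻¹ • v := by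
  by_cases hv0 : v = 0
  · simp [hv0]
  have hzμ : z - μ ≠ 0 := by
    intro h
    have hzμ' : z = μ := sub_eq_zero.1 h
    exact spectrum.mem_iff.1 (hzμ' ▸ mem_spectrum_of_apply_eq_smul hv hv0)
      (spectrum.mem_resolventSet_iff.1 hz)
  have h1 : resolvent T z * (algebraMap ℂ (E →L[ℂ] E) z - T) = 1 := by
    rw [spectrum.resolvent_eq hz]; exact hz.val_inv_mul
  have h2 := congrArg (fun S : E →L[ℂ] E => S v) h1
  simp only [mul_apply_eq_comp, one_apply_eq_self, algebraMap_sub_apply', hv] at h2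
  rw [← sub_smul, map_smul] at h2
  exact (eq_inv_smul_iff₀ hzμ).2 h2

/-- **The Riesz integral of an eigenvector**: if `T v = μ v` with `μ` in the open disc and the
circle in the resolvent set, then `(∮_{C(c,R)} (z − T)⁻¹ dz) v = 2πi • v`
(`resolvent_apply_of_apply_eq_smul` on the circle and `∮ (z − μ)⁻¹ dz = 2πi`; Kato III-§6.5:
eigenvectors lie in the range `M′` of the Riesz projection). [cite: Kato1966, III-§6.4 Thm. 6.17 (6.19) and III-§6.5] -/
theorem circleIntegral_resolvent_apply_of_apply_eq_smul {T : E →L[ℂ] E} {μ : ℂ} {v : E}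
    (hv : T v = μ • v) {c : ℂ} {R : ℝ} (hμ : μ ∈ ball c R) (hs : sphere c R ⊆ resolventSet ℂ T) :
    (∮ z in C(c, R), resolvent T z) v = (2 * Real.pi * I) • v := by
  have hR : 0 ≤ R := dist_nonneg.trans (mem_ball.1 hμ).le
  -- continuity of the integrand along the circle
  have hcont : Continuous fun θ : ℝ => resolvent T (circleMap c R θ) :=
    continuous_iff_continuousAt.2 fun θ =>
      ((spectrum.hasDerivAt_resolvent_const_left
        (hs (circleMap_mem_sphere c hR θ))).continuousAt).comp (continuous_circleMap c R).continuousAt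
  have hderiv : Continuous fun θ : ℝ => deriv (circleMap c R) θ := by
    simp_rw [deriv_circleMap]
    exact (continuous_circleMap 0 R).mul continuous_const
  have hint : IntervalIntegrable (fun θ : ℝ => deriv (circleMap c R) θ • resolvent T (circleMap c R θ))
      volume 0 (2 * Real.pi) :=
    (hderiv.smul hcont).intervalIntegrable _ _
  -- evaluation at `v` commutes with the integral
  have step1 : (∮ z in C(c, R), resolvent T z) v = ∮ z in C(c, R), resolvent T z v := by
    simp only [circleIntegral]
    rw [show (∫ θ in (0 : ℝ)..2 * Real.pi, deriv (circleMap c R) θ • resolvent T (circleMap c R θ)) v =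
        (ContinuousLinearMap.apply ℂ E v)
          (∫ θ in (0 : ℝ)..2 * Real.pi, deriv (circleMap c R) θ • resolvent T (circleMap c R θ))
        from rfl, ← ContinuousLinearMap.intervalIntegral_comp_comm _ hint]
    simp only [ContinuousLinearMap.apply_apply, smul_apply]
  have step2 : (∮ z in C(c, R), resolvent T z v) = ∮ z in C(c, R), (z - μ)⁻¹ • v :=
    circleIntegral.integral_congr hR fun z hz => resolvent_apply_of_apply_eq_smul hv (hs hz)
  rw [step1, step2, circleIntegral.integral_smul_const, circleIntegral.integral_sub_inv_of_mem_ball hμ]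

/-- **An eigenvalue inside the circle makes the Riesz integral non-zero** (`v ≠ 0`,
`T v = μ v`, `|μ − c| < R`, circle in the resolvent set). Together with
`spectrum_inter_ball_nonempty_of_circleIntegral_ne_zero` this is the elementary half of the
correspondence between spectrum inside `Γ` and the Riesz projection `P`. [cite: Kato1966, III-§6.4 Thm. 6.17 (6.19) and III-§6.5] -/
theorem circleIntegral_resolvent_ne_zero_of_apply_eq_smul {T : E →L[ℂ] E} {μ : ℂ} {v : E}
    (hv : T v = μ • v) (hv0 : v ≠ 0) {c : ℂ} {R : ℝ} (hμ : μ ∈ ball c R)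
    (hs : sphere c R ⊆ resolventSet ℂ T) : (∮ z in C(c, R), resolvent T z) ≠ 0 := by
  intro h0
  have h := circleIntegral_resolvent_apply_of_apply_eq_smul hv hμ hs
  rw [h0, zero_apply] at h
  have h2 : (2 * Real.pi * I : ℂ) ≠ 0 := by simp [Real.pi_ne_zero, I_ne_zero]
  exact hv0 ((smul_eq_zero.1 h.symm).resolve_left h2)

/-- **`P v = v` for eigenvectors inside the circle**: the Riesz projection fixes every
eigenvector whose eigenvalue lies in the open disc (Kato III-§6.5: the eigenspace, indeed the
algebraic eigenspace, of an isolated eigenvalue lies in `M′ = PX`).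
[cite: Kato1966, III-§6.4 Thm. 6.17 (6.19) and III-§6.5] -/
theorem rieszProjection_apply_of_apply_eq_smul {T : E →L[ℂ] E} {μ : ℂ} {v : E}
    (hv : T v = μ • v) {c : ℂ} {R : ℝ} (hμ : μ ∈ ball c R) (hs : sphere c R ⊆ resolventSet ℂ T) :
    rieszProjection T c R v = v := by
  have h2 : (2 * Real.pi * I : ℂ) ≠ 0 := by simp [Real.pi_ne_zero, I_ne_zero]
  rw [rieszProjection_def, smul_apply,
    circleIntegral_resolvent_apply_of_apply_eq_smul hv hμ hs, smul_smul, inv_mul_cancel₀ h2,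
    one_smul]

/-- Hence the Riesz projection is non-zero as soon as there is an eigenvalue (with a non-zero
eigenvector) inside the circle. [cite: Kato1966, III-§6.4 Thm. 6.17 (6.19) and III-§6.5] -/
theorem rieszProjection_ne_zero_of_apply_eq_smul {T : E →L[ℂ] E} {μ : ℂ} {v : E}
    (hv : T v = μ • v) (hv0 : v ≠ 0) {c : ℂ} {R : ℝ} (hμ : μ ∈ ball c R)
    (hs : sphere c R ⊆ resolventSet ℂ T) : rieszProjection T c R ≠ 0 := fun h0 =>
  hv0 (by simpa [h0] using (rieszProjection_apply_of_apply_eq_smul hv hμ hs).symm)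

end Operator

end Literature.Analysis.OperatorTheory
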